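import Summits.Langlands.Langlands.Theses.PhantomRMYoshida
import Summits.Langlands.Langlands.Theorems.PhantomRMYoshidaFaltingsTateModuleQGate
import Summits.Langlands.Langlands.Theorems.PhantomRMYoshidaStableYoshidaCongruenceSector

/-!
# Route PhantomRMYoshida — item `StableYoshidaCongruenceModFaltings` (stmt-Langlands-15108): its exact residue

The support item stmt-Langlands-15108 is `FaltingsFinitenessI → StableYoshidaCongruence` — crux 3 of the
route (`StableYoshidaCongruence`, item stmt-Langlands-13640: an endoscopic-to-stable congruence in Siegel
weight `(2,2)`) modulo the route's Faltings gate `FaltingsFinitenessI` (item stmt-Langlands-15084: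
Finiteness I over `ℚ`, Faltings 1983 §6 Satz 5–6 + Zarhin — a theorem in print, faithfully typed,
unformalised).  Since Finiteness I is true, the item has the truth value of the crux; this file makes the
bookkeeping exact by composing two things already in the tree:

* the crux lead's SECTOR THEOREM `…LevelThreeWeierstrassSwitch.stub_sectorModuloFacts`
  (`Theorems/PhantomRMYoshidaStableYoshidaCongruenceSector.lean`; sorry-free composition of the landed
  stubs 1a, 1b, 2, 3i, 3ii of the picked line `level-three-weierstrass-switch`): FIVE published facts,
  taken as hypotheses — Faltings 1983 §5 Satz 4 (`faltings_tate_bijective B B p`) and Satz 3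
  (`isSemisimpleRepresentation_rationalTateRep B p`), the Serre–Tate ordinary filtration
  (`ordinaryReduction_tateModule_filtration`), the Boxer–Calegari–Gee–Pilloni 2–3 switch onto a modular
  abelian surface (`bcgp_switch_exists_modular_abelianSurface`), the Weil pairing on `V_p`
  (`weilPairing_rationalTateModule`) — imply the crux's body `CruxAt p k red σ σ'` at every datum of the
  sector `p = 3 ∧ Switchable 3 k σ σ'`;
* the Finiteness-I discharges of the two Faltings inputs over `ℚ`
  (`faltings_tate_bijective_of_finitenessI`, `isSemisimpleRepresentation_rationalTateRep_of_finitenessI`,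
  `Theorems/PhantomRMYoshidaFaltingsTateModuleQGate.lean`).

Results:

* `cruxAt_sector_of_faltingsFinitenessI` — under `FaltingsFinitenessI` the crux holds on the `p = 3`
  switchable sector modulo exactly the three NON-Faltings facts;
* `stableYoshidaCongruence_of_faltingsFinitenessI_of_offSector` — the item follows from those three facts
  and the registered OPEN stub `stub_offSectorRemainder` of the line (the crux OFF the sector; its
  signature verbatim as hypothesis `hOff`), by the skeleton's glue (`crux_iff := Iff.rfl`, `by_cases` on
  the sector).

So the residue of stmt-Langlands-15108 is: three theorems in print (filed under `Literature/` with
locators, no `_holds`) and one open statement (expected dimension `-1` off the sector,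
`Cruxes/StableYoshidaCongruence/Disproof.lean` §6; handed back `promote-stub` by the crux lead,
`Cruxes/StableYoshidaCongruence/PromoteStubOffSectorRemainder.md`).  Nothing here bears on that remainder,
and nothing can: Finiteness I concerns abelian varieties, which supply stable points only on the sector.

Spelling note.  Since route-file rev 12 the gate renders stmt-Langlands-15108 as a `-- TODO … BLOCKED`
comment, so the constant `…Theses.PhantomRMYoshida.StableYoshidaCongruenceModFaltings` does not exist at
the time of writing (and rev 1 of the sibling file `…ModFaltings.lean`, which names it, no longer
elaborates).  The conclusions below are therefore spelled with the item's definiens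
`FaltingsFinitenessI → StableYoshidaCongruence`, which is the item by `rfl` once it is restated.

References: [Faltings1983Endlichkeit] §5 Satz 3–4, §6 Satz 5–6.  [BoxerCalegariGeePilloni2025]
(arXiv:2502.20645) Lemma 9.4.2, Thm. 8.3.2, Thm. 9.5.2.
-/

set_option linter.dupNamespace false -- project-wide option (lakefile weak.linter.dupNamespace); `Summit.Langlands.Langlands` is the mandated namespace

namespace Summit.Langlands.Langlands.Theorems.PhantomRMYoshida

open Literature.NumberTheory.GaloisRepresentations
open Literature.NumberTheory.DiophantineGeometry (weilPairing_rationalTateModule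
  ordinaryReduction_tateModule_filtration bcgp_switch_exists_modular_abelianSurface)
open Summit.Langlands.Langlands.Theses.PhantomRMYoshida
open Summit.Langlands.Langlands.Cruxes.StableYoshidaCongruence.LevelThreeWeierstrassSwitch

/-- **The crux on the `p = 3` switchable sector under Finiteness I, modulo three named facts.**  Granted
`FaltingsFinitenessI` (route decl, item stmt-Langlands-15084), the Serre–Tate ordinary filtration, the BCGP
2–3 switch + modularity and the Weil pairing, the body `CruxAt p k red σ σ'` of `StableYoshidaCongruence`
holds at every datum with `p = 3` and `Switchable 3 k σ σ'`: the sector theorem `stub_sectorModuloFacts`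
with its two Faltings hypotheses (Satz 4: `faltings_tate_bijective`; Satz 3:
`isSemisimpleRepresentation_rationalTateRep`) discharged from Finiteness I over `ℚ`.
[cite: Faltings1983Endlichkeit, §5 Satz 3–4, §6 Satz 5–6]
[cite: BoxerCalegariGeePilloni2025, Lemma 9.4.2, Thm. 8.3.2, Thm. 9.5.2 (arXiv:2502.20645)] -/
theorem cruxAt_sector_of_faltingsFinitenessI (hFin : FaltingsFinitenessI)
    (hST : ordinaryReduction_tateModule_filtration)
    (hBCGP : bcgp_switch_exists_modular_abelianSurface)
    (hWeil : weilPairing_rationalTateModule)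
    (p : ℕ) [Fact p.Prime] (hp : p ≠ 2) (k : Type) [Field k] [CharP k p] [IsAlgClosed k]
    [TopologicalSpace k] [DiscreteTopology k] (red : Valued.integer (PadicAlgCl p) →+* k)
    (σ σ' : FramedGaloisRep ℚ k 2) (hp3 : p = 3) (hsw : Switchable p k σ σ') :
    CruxAt p k red σ σ' :=
  stub_sectorModuloFacts (fun p _ B => faltings_tate_bijective_of_finitenessI hFin p B)
    (fun p _ B => isSemisimpleRepresentation_rationalTateRep_of_finitenessI hFin p B) hST hBCGP hWeil
    p hp k red σ σ' hp3 hsw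

/-- **Item stmt-Langlands-15108 modulo its exact residue.**  The item
`FaltingsFinitenessI → StableYoshidaCongruence` follows from the three non-Faltings facts of the sector
(Serre–Tate ordinary filtration, BCGP 2–3 switch + modularity, Weil pairing) together with the crux OFF
the `p = 3` switchable sector — the hypothesis `hOff` is verbatim the registered open stub
`stub_offSectorRemainder` of the line `level-three-weierstrass-switch`.  Proof: the skeleton's glue
(`crux_iff`, then `by_cases` on the sector; in the sector `cruxAt_sector_of_faltingsFinitenessI`).
[cite: Faltings1983Endlichkeit, §5 Satz 3–4, §6 Satz 5–6]
[cite: BoxerCalegariGeePilloni2025, Lemma 9.4.2, Thm. 8.3.2, Thm. 9.5.2 (arXiv:2502.20645)] -/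
theorem stableYoshidaCongruence_of_faltingsFinitenessI_of_offSector
    (hST : ordinaryReduction_tateModule_filtration)
    (hBCGP : bcgp_switch_exists_modular_abelianSurface)
    (hWeil : weilPairing_rationalTateModule)
    (hOff : ∀ (p : ℕ) [Fact p.Prime], p ≠ 2 → ∀ (k : Type) [Field k] [CharP k p] [IsAlgClosed k]
      [TopologicalSpace k] [DiscreteTopology k] (red : Valued.integer (PadicAlgCl p) →+* k)
      (σ σ' : FramedGaloisRep ℚ k 2),
      ¬ (p = 3 ∧ Switchable p k σ σ') → CruxAt p k red σ σ') :
    FaltingsFinitenessI → StableYoshidaCongruence := by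
  intro hFin
  refine crux_iff.mpr fun p _ hp k _ _ _ _ _ red σ σ' => ?_
  by_cases hsec : p = 3 ∧ Switchable p k σ σ'
  · exact cruxAt_sector_of_faltingsFinitenessI hFin hST hBCGP hWeil p hp k red σ σ' hsec.1 hsec.2
  · exact hOff p hp k red σ σ' hsec

end Summit.Langlands.Langlands.Theorems.PhantomRMYoshida
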